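import Literature.Probability.RandomPlanarGeometry.SLELawOneDomainReduction
import Literature.Probability.RandomPlanarGeometry.ChordalCurveFamily
import Literature.Probability.RandomPlanarGeometry.SimpleCurves
import Literature.Probability.RandomPlanarGeometry.ConformalRestrictionProofs
import HarnessLib

/-!
# Stub H3 `stub_rotationSLE` of line `six-class-type-ladder` (crux
`SAWDevelopingMap.ObservableToSLE`, stmt-CriticalPhenomena-10472): similarity transport on the
curve-space / SLE side

The line reduces carved-law identification for a CO-ORIENTED flat class `(j, j)` to the class
`(0, 0)` by rotating all data by `conj(ζ^j)`.  This file is the CURVE-SPACE half of that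
transport, for a plane homeomorphism `φ : ℂ ≃ₜ ℂ`:

1. **similarity covariance of chordal SLE_κ laws**: if `φ z = c z` (`c ≠ 0`) then the
   push-forward `φ_* ν` of a chordal SLE_κ law `ν` of a Dobrushin domain `D` is a chordal SLE_κ
   law of `φ(D) = D.map φ` — `φ` IS the similarity `similarity c hc 0` (`Homeomorph.ext`), and
   `IsSLELaw.map_conformal` applies to the conformal equivalence
   `ChordalFamily.similarityConformalEquiv c hc 0 D.carrier : D → c D` (boundary values
   `ChordalFamily.hasBoundaryValue_similarityConformalEquiv`), whose target is
   `(D.map φ).carrier` and whose marked points are `φ (D.pt i)` definitionally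
   (`MarkedDomain.carrier_map`, `MarkedDomain.pt_map`);
2. **isometry invariance of the injectivity-modulus events** `CurveClass.modulusClass ε θ`
   (an isometry preserves all the distances in `Curve.modulusSet`);
3. **functoriality** `φ⁻¹_* ∘ φ_* = id` on curve classes (`Curve.map` composition on a
   representative, `CurveClass.surjective_mk`);
4. **change of variables** `∫ f d(φ_* μ) = ∫ f ∘ φ_* dμ` for bounded continuous `f`
   (`MeasureTheory.integral_map`; `CurveClass.map` is continuous hence Borel,
   `CurveClass.measurable_map`).

References: G. F. Lawler, *Conformally Invariant Processes in the Plane*, AMS (2005), §6.1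
p. 149 (conformal image of chordal SLE_κ); M. Aizenman, A. Burchard, Duke Math. J. 99 (1999),
§2.1 (curve space, push-forwards).
-/

noncomputable section

open scoped NNReal BoundedContinuousFunction
open Set MeasureTheory Metric
open Literature.Probability.RandomPlanarGeometry

namespace Summit.CriticalPhenomena.SAWScalingLimit.Theorems.ObservableToSLE.TypeLadder

/-! ### (1) Similarity covariance of chordal SLE_κ laws -/

/-- A plane homeomorphism which is `z ↦ c z` pointwise is the similarity `similarity c hc 0`.
[folklore] -/
theorem homeomorph_eq_similarity (φ : ℂ ≃ₜ ℂ) {c : ℂ} (hc : c ≠ 0) (hφ : ∀ z, φ z = c * z) :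
    φ = similarity c hc 0 :=
  Homeomorph.ext fun z => by rw [hφ, similarity_apply, add_zero]

/-- **Similarity covariance of chordal SLE_κ laws.** For the similarity `z ↦ c z` (`c ≠ 0`) and a
chordal SLE_κ law `ν` of the Dobrushin domain `(D; a, b)`, the push-forward of `ν` along
`CurveClass.map (similarity c hc 0)` is a chordal SLE_κ law of `(c D; c a, c b)`: the similarity
restricts to a conformal equivalence `D → c D` with boundary values `a ↦ c a`, `b ↦ c b`
(`ChordalFamily.similarityConformalEquiv`,
`ChordalFamily.hasBoundaryValue_similarityConformalEquiv`), and `IsSLELaw.map_conformal`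
transports the law. [cite: Lawler2005, §6.1 p. 149] -/
theorem isSLELaw_map_similarity {c : ℂ} (hc : c ≠ 0) {κ : ℝ≥0} {D : DobrushinDomain}
    {ν : Measure (CurveClass ℂ)} (hν : IsSLELaw κ D ν) :
    IsSLELaw κ (D.map (similarity c hc 0))
      (ν.map (CurveClass.map ⟨similarity c hc 0, (similarity c hc 0).continuous⟩)) := by
  have h0 := ChordalFamily.hasBoundaryValue_similarityConformalEquiv c hc 0 D.carrier (D.pt 0)
  have h1 := ChordalFamily.hasBoundaryValue_similarityConformalEquiv c hc 0 D.carrier (D.pt 1)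
  exact hν.map_conformal (D := D.map (similarity c hc 0))
    (ChordalFamily.similarityConformalEquiv c hc 0 D.carrier) h0 h1 (fun z _ => rfl)

/-- **Similarity covariance of chordal SLE_κ laws, homeomorphism form.** If the plane
homeomorphism `φ` is `z ↦ c z` (`c ≠ 0`), the push-forward `φ_* ν` of a chordal SLE_κ law `ν` of
`D` is a chordal SLE_κ law of `D.map φ` (`isSLELaw_map_similarity` after identifying `φ` with
`similarity c hc 0`). [cite: Lawler2005, §6.1 p. 149] -/
theorem isSLELaw_map_of_eq_mul (φ : ℂ ≃ₜ ℂ) (c : ℂ) (hc : c ≠ 0) (hφ : ∀ z, φ z = c * z)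
    (κ : ℝ≥0) (D : DobrushinDomain) (ν : Measure (CurveClass ℂ)) (hν : IsSLELaw κ D ν) :
    IsSLELaw κ (D.map φ) (ν.map (CurveClass.map ⟨φ, φ.continuous⟩)) := by
  obtain rfl : φ = similarity c hc 0 := homeomorph_eq_similarity φ hc hφ
  exact isSLELaw_map_similarity hc hν

/-! ### (2) Isometry invariance of the injectivity-modulus events -/

/-- Pushing a curve forward along an isometry of the plane does not change whether it has
injectivity modulus `(ε, θ)` (all distances in `Curve.modulusSet` are preserved). [folklore] -/
theorem curveMap_mem_modulusSet_iff (φ : ℂ ≃ₜ ℂ) (hφ : Isometry φ) (ε θ : ℝ) (γ : Curve ℂ) :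
    γ.map ⟨φ, φ.continuous⟩ ∈ (Curve.modulusSet ε θ : Set (Curve ℂ)) ↔
      γ ∈ (Curve.modulusSet ε θ : Set (Curve ℂ)) := by
  simp only [Curve.modulusSet, Set.mem_setOf_eq, Curve.map_apply, ContinuousMap.coe_mk,
    hφ.dist_eq]

/-- **Isometry invariance of the modulus events**: for an isometry `φ` of the plane, the class
`φ_* x` has injectivity modulus `(ε, θ)` iff `x` does (`CurveClass.mk_mem_modulusClass_iff` on a
representative, `curveMap_mem_modulusSet_iff`). [folklore] -/
theorem curveClassMap_mem_modulusClass_iff (φ : ℂ ≃ₜ ℂ) (hφ : Isometry φ) (ε θ : ℝ)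
    (x : CurveClass ℂ) :
    CurveClass.map ⟨φ, φ.continuous⟩ x ∈ CurveClass.modulusClass ε θ ↔
      x ∈ CurveClass.modulusClass ε θ := by
  obtain ⟨γ, rfl⟩ := CurveClass.surjective_mk x
  rw [CurveClass.map_mk, CurveClass.mk_mem_modulusClass_iff, CurveClass.mk_mem_modulusClass_iff,
    curveMap_mem_modulusSet_iff φ hφ]

/-! ### (3) Functoriality: `φ⁻¹_* ∘ φ_* = id` -/

/-- `φ⁻¹_* (φ_* x) = x` on curve classes: on a representative `γ`, the curve
`φ⁻¹ ∘ φ ∘ γ` is `γ` (`Homeomorph.symm_apply_apply`). [folklore] -/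
theorem curveClassMap_symm_map (φ : ℂ ≃ₜ ℂ) (x : CurveClass ℂ) :
    CurveClass.map ⟨φ.symm, φ.symm.continuous⟩ (CurveClass.map ⟨φ, φ.continuous⟩ x) = x := by
  obtain ⟨γ, rfl⟩ := CurveClass.surjective_mk x
  rw [CurveClass.map_mk, CurveClass.map_mk]
  exact congrArg CurveClass.mk (Curve.ext (ContinuousMap.ext fun t => φ.symm_apply_apply _))

/-! ### (4) Change of variables for push-forwards along `CurveClass.map` -/

/-- Change of variables `∫ f d(φ_* μ) = ∫ (f ∘ φ_*) dμ` for a bounded continuous test function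
`f` (`MeasureTheory.integral_map`; `CurveClass.map φ` is Borel, `CurveClass.measurable_map`).
[folklore] -/
theorem integral_map_curveClassMap (φ : ℂ ≃ₜ ℂ) (μ : Measure (CurveClass ℂ))
    (f : CurveClass ℂ →ᵇ ℝ) :
    ∫ x, f x ∂(μ.map (CurveClass.map ⟨φ, φ.continuous⟩)) =
      ∫ x, f (CurveClass.map ⟨φ, φ.continuous⟩ x) ∂μ :=
  integral_map (CurveClass.measurable_map _).aemeasurable f.continuous.aestronglyMeasurable

/-! ### The stub -/

/-- **Registered stub `stub_rotationSLE`** (H3 of line `six-class-type-ladder`, crux item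
stmt-CriticalPhenomena-10472): similarity transport on the curve-space / SLE side, for plane
homeomorphisms `φ`.  (1) If `φ z = c z` (`c ≠ 0`), `φ_*` maps chordal SLE_κ laws of `D` to chordal
SLE_κ laws of `D.map φ` (`isSLELaw_map_of_eq_mul`: `IsSLELaw.map_conformal` along the similarity
conformal equivalence).  (2) If `φ` is an isometry, `φ_*` preserves the injectivity-modulus events
`CurveClass.modulusClass ε θ` (`curveClassMap_mem_modulusClass_iff`).  (3) `φ⁻¹_* ∘ φ_* = id`
(`curveClassMap_symm_map`).  (4) `∫ f d(φ_* μ) = ∫ (f ∘ φ_*) dμ` for bounded continuous `f`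
(`integral_map_curveClassMap`). [cite: Lawler2005, §6.1 p. 149] -/
theorem stub_rotationSLE :
    (∀ (φ : ℂ ≃ₜ ℂ) (c : ℂ), c ≠ 0 → (∀ z, φ z = c * z) →
      ∀ (κ : ℝ≥0) (D : DobrushinDomain) (ν : Measure (CurveClass ℂ)),
        IsSLELaw κ D ν → IsSLELaw κ (D.map φ) (ν.map (CurveClass.map ⟨φ, φ.continuous⟩))) ∧
    (∀ (φ : ℂ ≃ₜ ℂ), Isometry φ → ∀ (ε θ : ℝ) (x : CurveClass ℂ),
      CurveClass.map ⟨φ, φ.continuous⟩ x ∈ CurveClass.modulusClass ε θ ↔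
        x ∈ CurveClass.modulusClass ε θ) ∧
    (∀ (φ : ℂ ≃ₜ ℂ) (x : CurveClass ℂ),
      CurveClass.map ⟨φ.symm, φ.symm.continuous⟩ (CurveClass.map ⟨φ, φ.continuous⟩ x) = x) ∧
    (∀ (φ : ℂ ≃ₜ ℂ) (μ : Measure (CurveClass ℂ)) (f : CurveClass ℂ →ᵇ ℝ),
      ∫ x, f x ∂(μ.map (CurveClass.map ⟨φ, φ.continuous⟩)) =
        ∫ x, f (CurveClass.map ⟨φ, φ.continuous⟩ x) ∂μ) :=
  ⟨isSLELaw_map_of_eq_mul, curveClassMap_mem_modulusClass_iff, curveClassMap_symm_map,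
    integral_map_curveClassMap⟩

end Summit.CriticalPhenomena.SAWScalingLimit.Theorems.ObservableToSLE.TypeLadder

end
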